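import Literature.InformationTheory.QuantumCodes.SubsystemCodes
import Literature.InformationTheory.QuantumCodes.LocalCodeDistanceBound
import HarnessLib

/-!
# Bravyi–Terhal 2009, Theorem 1* (via Proposition 2): `d ≤ r·L^{D−1}` for subsystem codes with local stabilizer generators — proof

S. Bravyi, B. Terhal, arXiv:0810.1983 [BravyiTerhal2009]. §1.1 (chunk p0005 L28–52): «assume that we encode `k`
qubits using a stabilizer code `𝒮` with `g+k` logical qubits … regard the extra `g` logical qubits … as unused
“gauge qubits” … the relevant distance would be … `d(𝒢) = min_{P ∈ 𝒞(𝒮)∖𝒢} |P|`,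
`𝒢 = ⟨𝒮, X̄_1, Z̄_1, …, X̄_g, Z̄_g⟩` … Theorem 1*. Under the assumptions of Theorem 1 the distance `d(𝒢)` satisfies
the bound Eq. (2) [`d ≤ r L^{D−1}`] for any choice of logical operators `X̄_1, Z̄_1, …, X̄_g, Z̄_g` on the gauge
qubits.» §3.3 (p0013 L88–112, p0014 L1–27): «Clearly, `𝒢 ∩ 𝒞(𝒢) = 𝒮` … Proposition 2. Let `𝒢` be a subsystem code
on a lattice `Λ = {1,…,L}^D` with open or periodic boundary conditions. Assume that a stabilizer group
`𝒮 = 𝒢 ∩ 𝒞(𝒢)` has local generators, `𝒮 = ⟨S_1,…,S_m⟩`, such that the support of any generator `S_a` can be covered by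
a hypercube with `r^D` vertices. Then `d_1(𝒢) ≤ r` … Proof. … almost identical to the proof of Proposition 1 … instead
of cleaning out a logical operator `P ∈ 𝒞(𝒮)∖𝒮` using Lemma 1 one has to clean out a logical operator
`P ∈ 𝒞(𝒢)∖𝒢` using Lemma 2. After cleaning out all even strips … `P' ∈ 𝒞(𝒢)∖𝒢` that has support only on odd
strips … Since any generator of `𝒮` overlaps with at most one odd strip, the inclusion `P' ∈ 𝒞(𝒢) ⊆ 𝒞(𝒮)` implies
that a restriction of `P'` onto any odd strip is an element of `𝒞(𝒮)`. At least one of these restrictions is not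
an element of `𝒢`. Therefore … an element of `𝒞(𝒮)∖𝒢`. This is in contradiction with the assumption that
`d_1(𝒢) > r`. □ Theorems 1* and 2* are direct corollaries of Proposition 2. Indeed, choose any logical operator
`P ∈ 𝒞(𝒮)∖𝒢` with a linear dimension `d_1(P) ≤ r`. Then the weight of `P` is at most `rL^{D−1}`, that is,
`d(𝒢) ≤ rL^{D−1}` which proves Theorem 1*.»

THIS FILE PROVES Theorem 1* in the generality of Proposition 2 (any gauge space `Ḡ` whose stabilizer space
`S̄ = Ḡ ⊓ Ḡ⊥` has `r`-local generators; BT09's `𝒢 = ⟨𝒮, gauge logicals⟩` is the case in point, «clearly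
`𝒢 ∩ 𝒞(𝒢) = 𝒮`»), with OPEN boundary conditions and every `L` (as the tree's Theorem 1,
`BravyiTerhal2009_d_le_c_sqrt_n_holds` in `LocalCodeDistanceBound.lean`, whose slab machinery is reused verbatim),
on the subsystem vocabulary of `SubsystemCodes.lean` (`gaugeStabilizer`, `IsSubsystemCode`, the subsystem Cleaning
Lemma `sup_gaugeStabilizer_bare_compl_eq`):
`BravyiTerhal2009_theorem1_star : 1 ≤ D → 1 ≤ r → HasLocalGenerators e r (gaugeStabilizer Ḡ) → IsSubsystemCode Ḡ k d →
1 ≤ k → d ≤ r · L^{D−1}`.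

Proof (as printed): if no slab of width `w = max(r−1,1)` supports a dressed logical operator then (i*) a dressed
logical operator supported on the slabs of one parity splits slab by slab into elements of `Ḡ`
(`mem_gauge_of_mem_supportedOn_parityClass`), so the odd slabs are gauge-correctable; (ii*) Lemma 2 cleans every
BARE logical operator `P ∈ Ḡ⊥` off the odd slabs with a stabilizer, the remainder lives on the even slabs and is in
`Ḡ` by (i*): `Ḡ⊥ ≤ Ḡ` (`sympDual_gauge_le_of_slabs`), i.e. `S̄ = Ḡ⊥`, i.e. `k = 0` — contradiction. Hence some slab
supports a dressed logical operator, of weight `≤ w L^{D−1} ≤ r L^{D−1}`.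

Deliberately NOT here: periodic boundary conditions (Prop. 2 for `L ≥ 2(r−1)²`; the stabilizer case is
`LocalCodeDistanceBoundPeriodic.lean`), Theorem 2* (energy barrier with gauge qubits).

## References

* [BravyiTerhal2009] arXiv:0810.1983, read via `lit`: §1.1 Thm. 1* (chunk p0005 L28–52), §3.3 Def. 2, Prop. 2 and
  the proof of Thms. 1*–2* (p0013 L88–112, p0014 L1–27), §3.1 Lemma 2 (p0011 L8–30).

## Mathlib / tree search

Tree: `slab`, `parityClass`, `compl_parityClass_one`, `eq_sum_proj_slab`, `proj_slab_mem_sympDual`, `colSlab`,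
`slabPair_of_isCubeLocal`, `card_colSlab_le` (LocalCodeDistanceBound.lean); `gaugeStabilizer`, `IsSubsystemCode`,
`IsGaugeCorrectable`, `sup_gaugeStabilizer_bare_compl_eq`, `gaugeStabilizer_le`, `sympDual_le_sympDual_gaugeStabilizer`
(SubsystemCodes.lean); `HasLocalGenerators`, `IsCubeLocal` (LocalityBounds.lean); `proj_mem_supportedOn`,
`sympWeight_le_card_of_mem` (QuantumSingletonBound.lean).
-/

namespace Literature.InformationTheory.QuantumCodes

open Finset Module

variable {n : ℕ}

/-! ### Core: Proposition 2 on abstract slabs -/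

section Core

variable (β : Fin n → ℕ) {ι : Type*} (g : ι → SympVec n) {G : Submodule (ZMod 2) (SympVec n)}

/-- (i*) If no single slab supports a dressed logical operator, a dressed logical operator supported on the slabs of
one parity is a gauge operator («a restriction of `P'` onto any odd strip is an element of `𝒞(𝒮)` … [if all were in
`𝒢`, so would `P'` be]»). [cite: BravyiTerhal2009, §3.3 proof of Prop. 2 (p. 14)] -/
theorem mem_gauge_of_mem_supportedOn_parityClass
    (hS : gaugeStabilizer G = Submodule.span (ZMod 2) (Set.range g))
    (hsep : ∀ a, ∃ j₀ : ℕ, ∀ q ∈ sympSupport (g a), β q = j₀ ∨ β q = j₀ + 1)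
    (h0 : ∀ j, ∀ Q ∈ sympDual (gaugeStabilizer G), Q ∈ supportedOn (slab β j) → Q ∈ G)
    {p : ℕ} {P : SympVec n} (hPd : P ∈ sympDual (gaugeStabilizer G))
    (hPs : P ∈ supportedOn (parityClass β p)) : P ∈ G := by
  rw [eq_sum_proj_slab β hPs]
  refine Submodule.sum_mem _ fun j hj => h0 j _ ?_ (proj_mem_supportedOn _ P)
  have hj' : j % 2 = p := (mem_filter.1 hj).2
  rw [hS] at hPd ⊢
  exact proj_slab_mem_sympDual β g hsep hPd hPs hj'

/-- (ii*) **Core of Proposition 2.** If the stabilizer space `S̄ = ⟨g⟩` of the gauge space `Ḡ` has generators each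
meeting at most two adjacent slabs and no single slab supports a dressed logical operator, then `Ḡ⊥ ≤ Ḡ` (no
logical qubits): clean a bare logical operator off the odd slabs with a stabilizer (Lemma 2), the remainder lives
on the even slabs and is a gauge operator by (i*). [cite: BravyiTerhal2009, §3.3 proof of Prop. 2 (p. 14: «clean out a logical operator P ∈ 𝒞(𝒢)∖𝒢 using Lemma 2 … in contradiction with the assumption that d_1(𝒢) > r»)] -/
theorem sympDual_gauge_le_of_slabs
    (hS : gaugeStabilizer G = Submodule.span (ZMod 2) (Set.range g))
    (hsep : ∀ a, ∃ j₀ : ℕ, ∀ q ∈ sympSupport (g a), β q = j₀ ∨ β q = j₀ + 1)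
    (h0 : ∀ j, ∀ Q ∈ sympDual (gaugeStabilizer G), Q ∈ supportedOn (slab β j) → Q ∈ G) :
    sympDual G ≤ G := by
  intro P hP
  have hU : IsGaugeCorrectable G (parityClass β 1) := fun Q hQ hQs =>
    mem_gauge_of_mem_supportedOn_parityClass β g hS hsep h0 hQ hQs
  have hP' : P ∈ gaugeStabilizer G ⊔ (sympDual G ⊓ supportedOn (parityClass β 1)ᶜ) := by
    rw [sup_gaugeStabilizer_bare_compl_eq hU]; exact hP
  obtain ⟨s, hs, q, hq, rfl⟩ := Submodule.mem_sup.1 hP'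
  have hqs : q ∈ supportedOn (parityClass β 0) := by rw [← compl_parityClass_one β]; exact hq.2
  have hqd : q ∈ sympDual (gaugeStabilizer G) := sympDual_le_sympDual_gaugeStabilizer G hq.1
  exact G.add_mem (gaugeStabilizer_le G hs) (mem_gauge_of_mem_supportedOn_parityClass β g hS hsep h0 hqd hqs)

end Core

/-! ### Theorem 1* -/

/-- **Bravyi–Terhal 2009, Theorem 1* — proved** (open boundary conditions, every `L`, in the generality of Prop. 2).
«Under the assumptions of Theorem 1 the distance `d(𝒢)` satisfies the bound `d ≤ r L^{D−1}` for any choice of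
logical operators `X̄_1, Z̄_1, …, X̄_g, Z̄_g` on the gauge qubits», `d(𝒢) = min_{P ∈ 𝒞(𝒮)∖𝒢} |P|`,
`𝒢 = ⟨𝒮, X̄_1, …, Z̄_g⟩`; typed for every gauge space `Ḡ ≤ 𝔽₂^{2n}` on `{1,…,L}^D` (`D ≥ 1`, qubits placed by `e`)
whose stabilizer space `S̄ = Ḡ ⊓ Ḡ⊥` is spanned by elements of `S̄` each covered by a hypercube with `r^D` vertices
(`r ≥ 1`): if `Ḡ` has `k ≥ 1` logical qubits and no dressed logical operator of weight `< d`, then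
`d ≤ r · L^{D−1}`. Column: proved theorem. -- TODO(general form): periodic boundary conditions (Prop. 2, L ≥ 2(r−1)²).
[cite: BravyiTerhal2009, §1.1 Thm. 1* (p. 5) with §3.3 Prop. 2 and «Theorems 1* and 2* are direct corollaries of Proposition 2» (pp. 13–14)] -/
theorem BravyiTerhal2009_theorem1_star (D L r : ℕ) {k d : ℕ} (e : Fin n ≃ (Fin D → Fin L))
    (G : Submodule (ZMod 2) (SympVec n)) (hD : 1 ≤ D) (hr : 1 ≤ r)
    (hloc : HasLocalGenerators e r (gaugeStabilizer G)) (hcode : IsSubsystemCode G k d) (hk : 1 ≤ k) :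
    d ≤ r * L ^ (D - 1) := by
  obtain ⟨D', rfl⟩ : ∃ D', D = D' + 1 := ⟨D - 1, by omega⟩
  rw [Nat.add_sub_cancel]
  -- slab width w = max (r - 1) 1
  set w : ℕ := max (r - 1) 1 with hwdef
  have hw1 : 1 ≤ w := le_max_right _ _
  have hrw : r ≤ w + 1 := by have := le_max_left (r - 1) 1; omega
  have hwr : w ≤ r := max_le (Nat.sub_le r 1) hr
  by_contra hlt
  push Not at hlt
  -- the local generators of the stabilizer space
  set T : Set (SympVec n) := {v | v ∈ gaugeStabilizer G ∧ IsCubeLocal e r v} with hT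
  have hS : gaugeStabilizer G = Submodule.span (ZMod 2) (Set.range (Subtype.val : T → SympVec n)) := by
    rw [Subtype.range_coe]
    exact le_antisymm hloc (Submodule.span_le.2 fun v hv => hv.1)
  have hsep : ∀ a : T, ∃ j₀ : ℕ, ∀ q ∈ sympSupport (a : SympVec n),
      colSlab e 0 w q = j₀ ∨ colSlab e 0 w q = j₀ + 1 :=
    fun a => slabPair_of_isCubeLocal 0 hw1 hrw a.2.2
  -- no slab supports a dressed logical operator (it would have weight ≤ w L^{D'} ≤ r L^{D'} < d)
  have h0 : ∀ j, ∀ Q ∈ sympDual (gaugeStabilizer G), Q ∈ supportedOn (slab (colSlab e 0 w) j) → Q ∈ G := by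
    intro j Q hQd hQs
    by_contra hQG
    have h1 := hcode.2 Q hQd hQG
    have h2 := sympWeight_le_card_of_mem hQs
    have h3 := card_colSlab_le e w hw1 j
    have h4 : w * L ^ D' ≤ r * L ^ D' := Nat.mul_le_mul_right _ hwr
    omega
  -- hence Ḡ⊥ ≤ Ḡ, i.e. S̄ = Ḡ⊥: no logical qubits, contradicting k ≥ 1
  have hle : sympDual G ≤ G := sympDual_gauge_le_of_slabs (colSlab e 0 w) _ hS hsep h0
  have hSe : gaugeStabilizer G = sympDual G := inf_eq_right.2 hle
  have hdim := hcode.1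
  rw [hSe] at hdim
  omega

/-- **Theorem 1* in BT09's own framing** (a stabilizer code with some logical qubits gauged out): for a
self-orthogonal `S̄` with `r`-local generators and ANY gauge space `Ḡ` with `S̄ ≤ Ḡ` and `Ḡ ⊓ Ḡ⊥ = S̄` («clearly
`𝒢 ∩ 𝒞(𝒢) = 𝒮`»), `k ≥ 1` remaining logical qubits and dressed distance `≥ d`: `d ≤ r · L^{D−1}`.
[cite: BravyiTerhal2009, §1.1 Thm. 1* (p. 5: «for any choice of logical operators X̄_1, Z̄_1, …, X̄_g, Z̄_g on the gauge qubits») and §3.3 (p. 13)] -/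
theorem BravyiTerhal2009_theorem1_star' (D L r : ℕ) {k d : ℕ} (e : Fin n ≃ (Fin D → Fin L))
    (S G : Submodule (ZMod 2) (SympVec n)) (hD : 1 ≤ D) (hr : 1 ≤ r) (hloc : HasLocalGenerators e r S)
    (hSG : gaugeStabilizer G = S) (hcode : IsSubsystemCode G k d) (hk : 1 ≤ k) : d ≤ r * L ^ (D - 1) :=
  BravyiTerhal2009_theorem1_star D L r e G hD hr (hSG ▸ hloc) hcode hk

end Literature.InformationTheory.QuantumCodes
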